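import Summits.CriticalPhenomena.SAWScalingLimit.Theorems.SAWTotalPositivityCriticalBubbleBoundJoinDefs

/-!
# Rarity input of the JOIN-MASS ledger from an exponential tail (stub `Urar_le_of_tail` of line
`docking-census-joining`, crux stmt-CriticalPhenomena-7117
`Summit.CriticalPhenomena.SAWScalingLimit.Theses.SAWTotalPositivity.CriticalBubbleBound`)

The RARITY input `U_i ≤ C (i+1) R'_{i+1} + C 2^{-4i}` (exponents `π = 0`, `b = 1`) of the landed
ledger `Docking.stub_ledgerBootstrap` for the shifted class sequence `jterm`, derived from an
exponential tail bound on the class mass of lex-rooted polygons with at least `k` global join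
plaquettes (Hammond's Prop. 4.5 in `x_c`-mass form, which the neighbouring stubs of the line produce):

  `#{χ ∈ lexRooted N : k ≤ |gjoins N χ|} · x_c^{N+1} ≤ A ρ^k`  (all `N`, `k`; `0 < ρ < 1`).

Pure finite-sum real analysis:

* `sum_card_gjoins_le` — LAYER CAKE at fixed walk length `N`: for every cut-off `K`,
  `Σ_χ |gjoins N χ| x_c^{N+1} ≤ K · cterm N + (A/(1-ρ)) ρ^K` (`|gjoins| ≤ N+1`, then
  `|g| ≤ K + #{K ≤ k ≤ N : k+1 ≤ |g|}`, swap the sums, bound the tail by a geometric series);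
* `Urar_le_of_tail` — sum over the dyadic block `B_{i+1}` (`2^{i+1}` lengths) with the cut-off
  `K = 5 K₀ (i+1)`, where `ρ^{K₀} < 1/2`, so that `2^{i+2} ρ^K ≤ 2^{i+2} 2^{-5(i+1)} ≤ 2^{-4i}`.
-/

noncomputable section

open Literature.Probability.LatticeModels
open Literature.Probability.RandomPlanarGeometry Literature.Probability.RandomPlanarGeometry.SAW
open scoped BigOperators
open Summit.CriticalPhenomena.SAWScalingLimit.Theorems.CriticalBubbleBound.Negative (e₀)
open Summit.CriticalPhenomena.SAWScalingLimit.Theorems.CriticalBubbleBound.Docking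

namespace Summit.CriticalPhenomena.SAWScalingLimit.Theorems.CriticalBubbleBound.Join

/-- A polygon of walk length `N` has at most `N + 1` global join plaquettes (their lower-left
corners are among its `N + 1` vertices). [folklore] -/
private theorem card_gjoins_le (N : ℕ) (χ : ℕ → Site 2) : (gjoins N χ).card ≤ N + 1 :=
  calc (gjoins N χ).card ≤ (verts N χ).card :=
        Finset.card_le_card fun q hq => (mem_gjoins.1 hq).1
    _ ≤ (Finset.range (N + 1)).card := by unfold Docking.verts; exact Finset.card_image_le
    _ = N + 1 := Finset.card_range _

/-- LAYER CAKE with a cut-off: `|g| ≤ K + #{k ∈ [K, N+1) : k + 1 ≤ |g|}` for `|g| ≤ N + 1`.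
[folklore] -/
private theorem card_gjoins_le_add_card_filter (N K : ℕ) (χ : ℕ → Site 2) :
    (gjoins N χ).card ≤
      K + ((Finset.Ico K (N + 1)).filter fun k => k + 1 ≤ (gjoins N χ).card).card := by
  have hsub : Finset.Ico K (gjoins N χ).card ⊆
      (Finset.Ico K (N + 1)).filter fun k => k + 1 ≤ (gjoins N χ).card := by
    intro k hk
    rw [Finset.mem_Ico] at hk
    exact Finset.mem_filter.2
      ⟨Finset.mem_Ico.2 ⟨hk.1, hk.2.trans_le (card_gjoins_le N χ)⟩, Nat.succ_le_of_lt hk.2⟩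
  have h1 := Finset.card_le_card hsub
  rw [Nat.card_Ico] at h1
  omega

/-- LAYER CAKE at fixed walk length: under the exponential tail hypothesis, for every cut-off `K`,
`Σ_{χ ∈ lexRooted N} |gjoins N χ| · x_c^{N+1} ≤ K · cterm N + (A / (1 - ρ)) · ρ^K`. [folklore] -/
private theorem sum_card_gjoins_le {A ρ : ℝ} (hA : 0 ≤ A) (hρ : 0 < ρ) (hρ1 : ρ < 1)
    (H : ∀ N k : ℕ, (((lexRooted N).filter fun χ => k ≤ (gjoins N χ).card).card : ℝ) *
      criticalFugacity ^ (N + 1) ≤ A * ρ ^ k) (N K : ℕ) :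
    ∑ χ ∈ lexRooted N, ((gjoins N χ).card : ℝ) * criticalFugacity ^ (N + 1) ≤
      (K : ℝ) * cterm N + A / (1 - ρ) * ρ ^ K := by
  -- the layer cake in `ℕ`, summed over `χ` and with the two sums swapped
  have hnat : ∑ χ ∈ lexRooted N, (gjoins N χ).card ≤
      (lexRooted N).card * K + ∑ k ∈ Finset.Ico K (N + 1),
        ((lexRooted N).filter fun χ => k + 1 ≤ (gjoins N χ).card).card := by
    refine (Finset.sum_le_sum fun χ _ => card_gjoins_le_add_card_filter N K χ).trans ?_
    rw [Finset.sum_add_distrib, Finset.sum_const, smul_eq_mul]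
    simp only [Finset.card_filter]
    rw [Finset.sum_comm]
  have hreal : ∑ χ ∈ lexRooted N, ((gjoins N χ).card : ℝ) ≤
      ((lexRooted N).card : ℝ) * K + ∑ k ∈ Finset.Ico K (N + 1),
        (((lexRooted N).filter fun χ => k + 1 ≤ (gjoins N χ).card).card : ℝ) := by
    exact_mod_cast hnat
  have hx : 0 ≤ criticalFugacity ^ (N + 1) := pow_nonneg criticalFugacity_pos_lt_one'.1.le _
  have htail : 0 ≤ A / (1 - ρ) * ρ ^ K :=
    mul_nonneg (div_nonneg hA (sub_pos.2 hρ1).le) (pow_nonneg hρ.le _)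
  calc ∑ χ ∈ lexRooted N, ((gjoins N χ).card : ℝ) * criticalFugacity ^ (N + 1)
      = (∑ χ ∈ lexRooted N, ((gjoins N χ).card : ℝ)) * criticalFugacity ^ (N + 1) := by
        rw [Finset.sum_mul]
    _ ≤ (((lexRooted N).card : ℝ) * K + ∑ k ∈ Finset.Ico K (N + 1),
          (((lexRooted N).filter fun χ => k + 1 ≤ (gjoins N χ).card).card : ℝ)) *
          criticalFugacity ^ (N + 1) := mul_le_mul_of_nonneg_right hreal hx
    _ = (K : ℝ) * cterm N + ∑ k ∈ Finset.Ico K (N + 1),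
          (((lexRooted N).filter fun χ => k + 1 ≤ (gjoins N χ).card).card : ℝ) *
            criticalFugacity ^ (N + 1) := by
        rw [add_mul, Finset.sum_mul, cterm]; ring
    _ ≤ (K : ℝ) * cterm N + ∑ k ∈ Finset.Ico K (N + 1), A * ρ ^ (k + 1) :=
        add_le_add le_rfl (Finset.sum_le_sum fun k _ => H N (k + 1))
    _ = (K : ℝ) * cterm N + ρ * (A * ∑ k ∈ Finset.Ico K (N + 1), ρ ^ k) := by
        rw [Finset.mul_sum, Finset.mul_sum]
        exact congrArg _ (Finset.sum_congr rfl fun k _ => by ring)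
    _ ≤ (K : ℝ) * cterm N + ρ * (A * (ρ ^ K / (1 - ρ))) :=
        add_le_add le_rfl (mul_le_mul_of_nonneg_left
          (mul_le_mul_of_nonneg_left (geom_sum_Ico_le_of_lt_one hρ.le hρ1) hA) hρ.le)
    _ = (K : ℝ) * cterm N + ρ * (A / (1 - ρ) * ρ ^ K) := by ring
    _ ≤ (K : ℝ) * cterm N + A / (1 - ρ) * ρ ^ K :=
        add_le_add le_rfl (mul_le_of_le_one_left htail hρ1.le)

/-- **Rarity input of the ledger from an exponential tail** (registered stub `Urar_le_of_tail`):
if the class mass of lex-rooted polygons of walk length `N` with at least `k` global join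
plaquettes is at most `A ρ^k` uniformly in `N` (`0 < ρ < 1`), then the rarity-side mass of the
ledger satisfies `U_i ≤ C (i+1) R'_{i+1} + C 2^{-4i}` with `R'_{i+1} = blockMass jterm (i+1)`
(exponents `π = 0`, `b = 1` of `Docking.stub_ledgerBootstrap`).  Layer cake per length with the
cut-off `K = 5 K₀ (i+1)` (`ρ^{K₀} < 1/2`), summed over the `2^{i+1}` lengths of the block `B_{i+1}`.
[cite: Hammond2015SAPJoining, Proposition 4.5] -/
theorem Urar_le_of_tail : ∀ (A ρ : ℝ), 0 ≤ A → 0 < ρ → ρ < 1 → (∀ N k : ℕ, (((lexRooted N).filter fun χ => k ≤ (gjoins N χ).card).card : ℝ) * criticalFugacity ^ (N + 1) ≤ A * ρ ^ k) → ∃ C : ℝ, ∀ i : ℕ, Urar i ≤ C * ((i : ℝ) + 1) * blockMass jterm (i + 1) + C * (2 : ℝ) ^ (-(4 : ℝ) * (i : ℝ)) := by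
  intro A ρ hA hρ hρ1 H
  obtain ⟨K₀, hK₀⟩ : ∃ K₀ : ℕ, ρ ^ K₀ < 1 / 2 := exists_pow_lt_of_lt_one (by norm_num) hρ1
  have hB0 : 0 ≤ A / (1 - ρ) := div_nonneg hA (sub_pos.2 hρ1).le
  refine ⟨max (5 * (K₀ : ℝ)) (A / (1 - ρ)), fun i => ?_⟩
  have hbm : 0 ≤ blockMass jterm (i + 1) := blockMass_nonneg jterm_nonneg _
  -- termwise bound over the block, cut-off `K = K₀ * (5 * (i + 1))`
  have key : ∀ n ∈ block (i + 1),
      (if joinShift ≤ n then ∑ χ ∈ lexRooted (n - joinShift),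
          ((gjoins (n - joinShift) χ).card : ℝ) * criticalFugacity ^ (n - joinShift + 1) else 0) ≤
        ((K₀ * (5 * (i + 1)) : ℕ) : ℝ) * jterm n + A / (1 - ρ) * ρ ^ (K₀ * (5 * (i + 1))) := by
    intro n _
    split_ifs with h
    · rw [jterm_of_le h]
      exact sum_card_gjoins_le hA hρ hρ1 H (n - joinShift) (K₀ * (5 * (i + 1)))
    · rw [jterm_of_lt (not_le.1 h), mul_zero, zero_add]
      exact mul_nonneg hB0 (pow_nonneg hρ.le _)
  -- the geometric factor beats the number of lengths in the block
  have hK : ρ ^ (K₀ * (5 * (i + 1))) ≤ ((2 : ℝ) ^ (5 * (i + 1)))⁻¹ := by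
    rw [pow_mul, ← inv_pow, ← one_div]
    exact pow_le_pow_left₀ (pow_nonneg hρ.le _) hK₀.le _
  have hblock : ((block (i + 1)).card : ℝ) ≤ (2 : ℝ) ^ (i + 2) := by
    have : (block (i + 1)).card ≤ 2 ^ (i + 2) := by
      rw [block, Nat.card_Ico]; exact Nat.sub_le _ _
    exact_mod_cast this
  have haux : (2 : ℝ) ^ (i + 2) * ((2 : ℝ) ^ (5 * (i + 1)))⁻¹ ≤ ((2 : ℝ) ^ (4 * i))⁻¹ := by
    rw [← one_div, ← one_div, mul_one_div, div_le_div_iff₀ (by positivity) (by positivity), one_mul,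
      ← pow_add]
    exact pow_le_pow_right₀ (by norm_num) (by omega)
  have hrpow : (2 : ℝ) ^ (-(4 : ℝ) * (i : ℝ)) = ((2 : ℝ) ^ (4 * i))⁻¹ := by
    rw [neg_mul, Real.rpow_neg (by norm_num : (0 : ℝ) ≤ 2),
      show (4 : ℝ) * (i : ℝ) = ((4 * i : ℕ) : ℝ) by push_cast; ring, Real.rpow_natCast]
  calc Urar i ≤ ∑ n ∈ block (i + 1),
        (((K₀ * (5 * (i + 1)) : ℕ) : ℝ) * jterm n + A / (1 - ρ) * ρ ^ (K₀ * (5 * (i + 1)))) := by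
        unfold Urar; exact Finset.sum_le_sum key
    _ = ((K₀ * (5 * (i + 1)) : ℕ) : ℝ) * blockMass jterm (i + 1) +
          ((block (i + 1)).card : ℝ) * (A / (1 - ρ) * ρ ^ (K₀ * (5 * (i + 1)))) := by
        rw [Finset.sum_add_distrib, ← Finset.mul_sum, Finset.sum_const, nsmul_eq_mul, blockMass]
    _ ≤ ((K₀ * (5 * (i + 1)) : ℕ) : ℝ) * blockMass jterm (i + 1) +
          (2 : ℝ) ^ (i + 2) * (A / (1 - ρ) * ((2 : ℝ) ^ (5 * (i + 1)))⁻¹) :=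
        add_le_add le_rfl (mul_le_mul hblock (mul_le_mul_of_nonneg_left hK hB0)
          (mul_nonneg hB0 (pow_nonneg hρ.le _)) (by positivity))
    _ = 5 * (K₀ : ℝ) * ((i : ℝ) + 1) * blockMass jterm (i + 1) +
          A / (1 - ρ) * ((2 : ℝ) ^ (i + 2) * ((2 : ℝ) ^ (5 * (i + 1)))⁻¹) := by
        push_cast; ring
    _ ≤ max (5 * (K₀ : ℝ)) (A / (1 - ρ)) * ((i : ℝ) + 1) * blockMass jterm (i + 1) +
          max (5 * (K₀ : ℝ)) (A / (1 - ρ)) * ((2 : ℝ) ^ (4 * i))⁻¹ :=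
        add_le_add
          (mul_le_mul_of_nonneg_right
            (mul_le_mul_of_nonneg_right (le_max_left _ _) (by positivity)) hbm)
          (mul_le_mul (le_max_right _ _) haux (by positivity) (hB0.trans (le_max_right _ _)))
    _ = _ := by rw [hrpow]

end Summit.CriticalPhenomena.SAWScalingLimit.Theorems.CriticalBubbleBound.Join

end
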